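import Mathlib
import Summits.KontsevichZagierPeriods.KontsevichZagierPeriods.Theorems.SoloInformedNashPieces
import HarnessLib

/-!
# SoloInformed — Nash chains: chordal paths through a vertex family in a chain of charts

File H2 of the Nash-replacement construction (APPROX) of `paper/rung2-v2.md` §4.4.
A *chain* on a smooth affine `ℚ̄`-curve `Z` is a number `N ≥ 1` of pieces and, for each piece
`r < N`, a local holomorphic chart `ψ_r : B_r → Z(ℂ) ∩ Ω_r` with the graph property
(`SoloInformedChart`, the output of `exists_localChart`). A vertex family `x = (x_r)_{r ≤ N}` is
*admissible* if `x_r ∈ Z(ℂ) ∩ Ω_r ∩ Ω_{r−1}`. The *chordal path* through `x` is the telescoped sum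
`Γ_x(t) = x_0 + Σ_{r<N} (e_r(t) − x_r)` of the chordal chart pieces
`e_r(t) = ψ_r(segPoint (x_r)_{i_r} (x_{r+1})_{i_r} (σ_{N,r} t))` (`soloInformedChartPiece`); by
`telescope_eval` it restricts to `e_k` on `[k/N, (k+1)/N]`, since consecutive pieces agree at the
grid points by the graph property. `Γ_x` is continuous, `C¹` on `[−1, 2]`, lies on `Z(ℂ)` over
`[0, 1]`, runs from `x_0` to `x_N`, and is a Nash path (`SoloInformedIsNashPath`) as soon as all
vertices have algebraic coordinates (`soloInformed_isNashPath_gamma`): this is the replacement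
path of Proposition 4.4. References: Bochnak–Coste–Roy 1998, §8.1; Huber–Wüstholz 2022, §3.3.1.
-/

noncomputable section

open Set Metric
open Literature.NumberTheory.Transcendental Literature.NumberTheory.Transcendental.KZ
open Literature.NumberTheory.Transcendental.CurvePeriods
open Literature.ModelTheory.ExponentialFields (IsSemialgebraic)

namespace Summit.KontsevichZagierPeriods.KontsevichZagierPeriods.Theorems

variable {Z : CurveData}

/-! ### Charts and chains -/

/-- A local holomorphic chart of `Z` over the coordinate `i₀` with the graph property
`Z(ℂ) ∩ Ω = ψ(B)`, `B = ball w₀ ε` (the output of `exists_localChart`). -/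
structure SoloInformedChart (Z : CurveData) where
  /-- The chart coordinate. -/
  i₀ : Fin Z.n
  /-- The centre of the parameter disc. -/
  w₀ : ℂ
  /-- The radius of the parameter disc. -/
  ε : ℝ
  /-- The open set of `ℂⁿ` covered by the chart. -/
  Ω : Set (Fin Z.n → ℂ)
  /-- The chart map. -/
  ψ : ℂ → Fin Z.n → ℂ
  /-- `Ω` is open. -/
  isOpen : IsOpen Ω
  /-- `ψ` is holomorphic on the disc. -/
  analytic : AnalyticOnNhd ℂ ψ (ball w₀ ε)
  /-- Graph property: points of `Z(ℂ) ∩ Ω` are `ψ` of their `i₀`-coordinate. -/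
  left_inv : ∀ z ∈ Ω, z ∈ Z.points → z i₀ ∈ ball w₀ ε ∧ ψ (z i₀) = z
  /-- Graph property: `ψ(B) ⊆ Z(ℂ) ∩ Ω` and `ψ(w)_{i₀} = w`. -/
  right_inv : ∀ w ∈ ball w₀ ε, ψ w ∈ Ω ∧ ψ w ∈ Z.points ∧ ψ w i₀ = w

namespace SoloInformedChart

variable (c : SoloInformedChart Z)

/-- The chart map is continuous on the disc. -/
theorem continuousOn : ContinuousOn c.ψ (ball c.w₀ c.ε) := c.analytic.continuousOn

/-- A point of `Z(ℂ) ∩ Ω` is `ψ` of its coordinate. -/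
theorem apply_coord {z : Fin Z.n → ℂ} (hzΩ : z ∈ c.Ω) (hz : z ∈ Z.points) : c.ψ (z c.i₀) = z :=
  (c.left_inv z hzΩ hz).2

/-- The coordinate of a point of `Z(ℂ) ∩ Ω` lies in the disc. -/
theorem coord_mem {z : Fin Z.n → ℂ} (hzΩ : z ∈ c.Ω) (hz : z ∈ Z.points) : z c.i₀ ∈ ball c.w₀ c.ε :=
  (c.left_inv z hzΩ hz).1

end SoloInformedChart

/-- Every point of a smooth affine curve over `ℚ̄` has a chart. [Huber–Wüstholz 2022, §3.3.1] -/
theorem soloInformed_exists_chart (hZ : Z.IsSmoothAffineCurve) {z₀ : Fin Z.n → ℂ}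
    (hz₀ : z₀ ∈ Z.points) : ∃ c : SoloInformedChart Z, z₀ ∈ c.Ω := by
  obtain ⟨i₀, ε, Ω, ψ, _, hΩ, hzΩ, hψ, h1, h2⟩ := hZ.exists_localChart hz₀
  exact ⟨⟨i₀, z₀ i₀, ε, Ω, ψ, hΩ, hψ, h1, h2⟩, hzΩ⟩

/-- A chain of `N ≥ 1` charts (only the charts `r < N` are used). -/
structure SoloInformedChain (Z : CurveData) where
  /-- The number of pieces. -/
  N : ℕ
  /-- There is at least one piece. -/
  N_pos : 0 < N
  /-- The chart of the `r`-th piece. -/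
  chart : ℕ → SoloInformedChart Z

namespace SoloInformedChain

variable (C : SoloInformedChain Z) {x : ℕ → Fin Z.n → ℂ}

/-- Admissible vertex families: `x_r ∈ Z(ℂ)`, `x_r, x_{r+1} ∈ Ω_r`. -/
def Adm (x : ℕ → Fin Z.n → ℂ) : Prop :=
  (∀ r ≤ C.N, x r ∈ Z.points) ∧ (∀ r < C.N, x r ∈ (C.chart r).Ω) ∧
    ∀ r < C.N, x (r + 1) ∈ (C.chart r).Ω

/-- The vertices of an admissible family lie on the curve. -/
theorem Adm.mem {C : SoloInformedChain Z} (hx : C.Adm x) : ∀ r ≤ C.N, x r ∈ Z.points := hx.1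

/-- The left vertex of piece `r` lies in `Ω_r`. -/
theorem Adm.memΩ {C : SoloInformedChain Z} (hx : C.Adm x) : ∀ r < C.N, x r ∈ (C.chart r).Ω :=
  hx.2.1

/-- The right vertex of piece `r` lies in `Ω_r`. -/
theorem Adm.memΩ' {C : SoloInformedChain Z} (hx : C.Adm x) :
    ∀ r < C.N, x (r + 1) ∈ (C.chart r).Ω := hx.2.2

/-- The `r`-th chordal piece through the vertex family `x`. -/
def piece (x : ℕ → Fin Z.n → ℂ) (r : ℕ) (t : ℝ) : Fin Z.n → ℂ :=
  soloInformedChartPiece (C.chart r).ψ (x r (C.chart r).i₀) (x (r + 1) (C.chart r).i₀) C.N r t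

/-- **The chordal path** `Γ_x(t) = x_0 + Σ_{r<N} (e_r(t) − x_r)`. -/
def gamma (x : ℕ → Fin Z.n → ℂ) (t : ℝ) : Fin Z.n → ℂ :=
  x 0 + ∑ r ∈ Finset.range C.N, (C.piece x r t - x r)

/-- Left of piece `r` the piece sits at `x_r`. -/
theorem piece_of_le (hx : C.Adm x) {r : ℕ} (hr : r < C.N) {t : ℝ} (ht : t ≤ (r : ℝ) / C.N) :
    C.piece x r t = x r := by
  rw [piece, soloInformedChartPiece_of_le C.N_pos ht]
  exact (C.chart r).apply_coord (hx.memΩ r hr) (hx.mem r hr.le)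

/-- Right of piece `r` the piece sits at `x_{r+1}`. -/
theorem piece_of_ge (hx : C.Adm x) {r : ℕ} (hr : r < C.N) {t : ℝ} (ht : ((r : ℝ) + 1) / C.N ≤ t) :
    C.piece x r t = x (r + 1) := by
  rw [piece, soloInformedChartPiece_of_ge C.N_pos ht]
  exact (C.chart r).apply_coord (hx.memΩ' r hr) (hx.mem (r + 1) hr)

/-- The chord parameters of piece `r` lie in the disc `B_r`. -/
theorem chord_mem (hx : C.Adm x) {r : ℕ} (hr : r < C.N) :
    x r (C.chart r).i₀ ∈ ball (C.chart r).w₀ (C.chart r).ε ∧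
      x (r + 1) (C.chart r).i₀ ∈ ball (C.chart r).w₀ (C.chart r).ε :=
  ⟨(C.chart r).coord_mem (hx.memΩ r hr) (hx.mem r hr.le),
    (C.chart r).coord_mem (hx.memΩ' r hr) (hx.mem (r + 1) hr)⟩

/-- **Telescoping**: on `[k/N, (k+1)/N]` the chordal path is the `k`-th piece. -/
theorem gamma_eq_piece (hx : C.Adm x) {k : ℕ} (hk : k < C.N) {t : ℝ}
    (ht : t ∈ Icc ((k : ℝ) / C.N) (((k : ℝ) + 1) / C.N)) : C.gamma x t = C.piece x k t := by
  have hN : (0 : ℝ) ≤ C.N := Nat.cast_nonneg _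
  refine telescope_eval x (fun r => C.piece x r t) hk (fun r hr => ?_) (fun r hkr hrN => ?_)
  · refine C.piece_of_ge hx (hr.trans hk) (le_trans ?_ ht.1)
    exact div_le_div_of_nonneg_right (by exact_mod_cast Nat.succ_le_of_lt hr) hN
  · refine C.piece_of_le hx hrN (le_trans ht.2 ?_)
    exact div_le_div_of_nonneg_right (by exact_mod_cast Nat.succ_le_of_lt hkr) hN

/-- `Γ_x(0) = x_0`. -/
theorem gamma_zero (hx : C.Adm x) : C.gamma x 0 = x 0 := by
  have h := C.gamma_eq_piece hx C.N_pos (t := 0)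
    ⟨by simp, div_nonneg (by norm_num) (Nat.cast_nonneg _)⟩
  rw [h, C.piece_of_le hx C.N_pos (by simp)]

/-- `Γ_x(1) = x_N`. -/
theorem gamma_one (hx : C.Adm x) : C.gamma x 1 = x C.N := by
  have hN : (0 : ℝ) < C.N := by exact_mod_cast C.N_pos
  have hk : C.N - 1 < C.N := Nat.sub_lt C.N_pos one_pos
  have hc : ((C.N - 1 : ℕ) : ℝ) + 1 = C.N := by
    rw [Nat.cast_sub (Nat.one_le_of_lt C.N_pos)]
    push_cast
    ring
  have h1 : (((C.N - 1 : ℕ) : ℝ) + 1) / C.N = 1 := by rw [hc, div_self hN.ne']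
  have h := C.gamma_eq_piece hx hk (t := 1) ⟨?_, by rw [h1]⟩
  · rw [h, C.piece_of_ge hx hk (by rw [h1]), Nat.sub_add_cancel (Nat.one_le_of_lt C.N_pos)]
  · rw [div_le_one hN]
    exact_mod_cast Nat.sub_le C.N 1

/-- Over `[0, 1]` the chordal path lies on `Z(ℂ)`; it also lies in the `Ω_k` of its piece. -/
theorem gamma_mem (hx : C.Adm x) {t : ℝ} (ht : t ∈ Icc (0 : ℝ) 1) : C.gamma x t ∈ Z.points := by
  obtain ⟨k, hk, hkt, htk⟩ := exists_piece_index C.N_pos ht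
  rw [C.gamma_eq_piece hx hk ⟨hkt, htk⟩]
  exact (soloInformedChartPiece_mem C.N_pos (C.chart k).right_inv (C.chord_mem hx hk).1
    (C.chord_mem hx hk).2 t).2

/-- The chordal path is continuous. -/
theorem continuous_gamma (hx : C.Adm x) : Continuous (C.gamma x) := by
  unfold gamma
  refine continuous_const.add (continuous_finsetSum _ fun r hr => ?_)
  have hr' : r < C.N := Finset.mem_range.mp hr
  exact (continuous_soloInformedChartPiece C.N_pos (C.chart r).continuousOn (C.chord_mem hx hr').1
    (C.chord_mem hx hr').2).sub continuous_const

/-- The chordal path is `C¹` on `[−1, 2]`. -/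
theorem contDiffOn_gamma (hx : C.Adm x) : ContDiffOn ℝ 1 (C.gamma x) (Icc (-1) 2) := by
  unfold gamma
  refine contDiffOn_const.add (ContDiffOn.sum fun r hr => ?_)
  have hr' : r < C.N := Finset.mem_range.mp hr
  exact (soloInformed_contDiffOn_chartPiece hr' (C.chart r).analytic (C.chord_mem hx hr').1
    (C.chord_mem hx hr').2).sub contDiffOn_const

/-- **The chordal path through an admissible algebraic vertex family is a `CurvePath`.** -/
def curvePath (hx : C.Adm x) (h0 : ∀ i, IsAlgebraic ℚ (x 0 i)) (hN : ∀ i, IsAlgebraic ℚ (x C.N i)) :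
    CurvePath Z where
  toFun := C.gamma x
  contDiffOn := (C.contDiffOn_gamma hx).mono (Icc_subset_Icc (by norm_num) (by norm_num))
  mem_points := fun _ ht => C.gamma_mem hx ht
  algebraic_zero := fun i => by rw [C.gamma_zero hx]; exact h0 i
  algebraic_one := fun i => by rw [C.gamma_one hx]; exact hN i

/-- The underlying function of `curvePath`. -/
@[simp] theorem curvePath_toFun (hx : C.Adm x) (h0 : ∀ i, IsAlgebraic ℚ (x 0 i))
    (hN : ∀ i, IsAlgebraic ℚ (x C.N i)) : (C.curvePath hx h0 hN).toFun = C.gamma x := rfl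

/-- **The chordal path through an admissible vertex family with algebraic coordinates is a Nash
path.** [BCR 1998, Prop. 8.1.8; Huber–Wüstholz 2022, §3.3.1] -/
theorem isNashPath_gamma (hZ : Z.IsSmoothAffineCurve) (hx : C.Adm x)
    (halg : ∀ r ≤ C.N, ∀ i, IsAlgebraic ℚ (x r i)) : SoloInformedIsNashPath (C.gamma x) := by
  have hs : IsSemialgebraic ℚ (soloInformedIoo1 (-1) 2) := by
    simpa using isSemialgebraic_soloInformedIoo1 (-1) 2
  refine ⟨1, one_pos, ?_, fun j => ?_⟩
  · refine (C.contDiffOn_gamma hx).mono fun t ht => ⟨?_, ?_⟩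
    · push_cast at ht; linarith [ht.1]
    · push_cast at ht; linarith [ht.2]
  · have hset :
        soloInformedIoo1 (-((1 : ℚ) : ℝ)) (1 + ((1 : ℚ) : ℝ)) = soloInformedIoo1 (-1) 2 := by
      norm_num
    rw [hset]
    have hsum : SoloInformedReImSA (soloInformedIoo1 (-1) 2)
        (fun u => ∑ r ∈ Finset.range C.N, (C.piece x r (u 0) j - x r j)) := by
      refine SoloInformedReImSA.sum hs _ fun r hr => ?_
      have hr' : r < C.N := Finset.mem_range.mp hr
      have hp := soloInformed_reImSA_chartPiece (N := C.N) (r := r) C.N_pos hZ.algebraic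
        (C.chart r).isOpen (C.chart r).continuousOn (C.chart r).left_inv (C.chart r).right_inv
        (C.chord_mem hx hr').1 (C.chord_mem hx hr').2 (halg r hr'.le _) (halg (r + 1) hr' _) j
      exact (hp.add (SoloInformedReImSA.const hs ((halg r hr'.le j).neg))).congr
        fun u _ => (sub_eq_add_neg _ _).symm
    refine ((SoloInformedReImSA.const hs (halg 0 (Nat.zero_le _) j)).add hsum).congr fun u _ => ?_
    simp only [gamma, Pi.add_apply, Finset.sum_apply, Pi.sub_apply]

end SoloInformedChain

end Summit.KontsevichZagierPeriods.KontsevichZagierPeriods.Theorems
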